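import Mathlib
import HarnessLib

/-!
# Regge–Wheeler-type waves on the tortoise line: potentials, exterior-cone energies,
# channel energies and the non-radiative kernel

A small, Mathlib-only home for the `1+1`-dimensional reduction of linear waves on the
Schwarzschild exterior.  After separation into spherical harmonics and passage to the tortoise
(Regge–Wheeler) coordinate `x = r*` (`ReggeWheelerTortoise.lean`), a spin-`s` field of angular
number `ℓ ≥ s` obeys `ψ_tt − ψ_xx + V_{s,ℓ}(r(x)) ψ = 0` with
`V_{s,ℓ}(r) = (1 − 2M/r)(ℓ(ℓ+1)/r² + (1 − s²)·2M/r³)` (`s = 0` scalar waves, `s = 1` Maxwell,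
`s = 2` odd-parity metric perturbations: Regge–Wheeler 1957; Chandrasekhar, Ch. 4 §24,
eqs. (27)–(28); unified spin-`s` form: Brito–Cardoso–Pani, App. F, eq. (F.1) with `f = 1/B =
1 − 2M/r`, `p_rad = ρ = 0`).

Contents (namespace `Literature.Geometry.Lorentzian.ReggeWheeler`):

* `rwPotential M s ℓ ρ` and its pull-back `linePotential M s ℓ r` to the tortoise line along a
  radius function `r`; the three classical cases, `rwPotential_nonneg` (`ℓ ≥ s`, `ρ ≥ 2M`),
  vanishing at the horizon, and the photon-sphere bound `(1 − 2M/ρ)/ρ² ≤ 1/(27M²)` (equality at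
  `ρ = 3M`: the `s = 1` barrier peaks exactly at the photon sphere for every `ℓ`).
* For a general potential `V : ℝ → ℝ` on the line (the flat comparison theory of
  Duyckaerts–Kenig–Merle, Kenig–Lawrie–Liu–Schlag, Côte–Laurent has `V = 0`): the energy density
  `energyDensity V φ t x = φ_t² + φ_x² + V φ²`, classical solutions
  `IsSolutionAt / IsSolutionOn / IsSolution` (`C²` and `φ_tt − φ_xx + Vφ = 0`), the open exterior
  cone `exteriorCone xc ρ = {ρ + |t| < |x − xc|}`, the **exterior energy**
  `exteriorEnergy V xc ρ φ t = ∫_{ρ+|t|<|x−xc|} e[φ](t,x) dx : ℝ≥0∞`, the **channel energy**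
  `channelEnergy V xc ρ φ l = liminf_l exteriorEnergy` along a time filter `l` (`atTop`: the
  forward channel ends `𝓘⁺`/`𝓗⁺`, `atBot`: the backward ones), the one-ended far versions
  `farEnergy / farChannelEnergy` on `{x > xe + |t|}`, `totalEnergy`, `CauchyDataSupportedOn`, the
  candidate non-radiative kernel `rwKernel V xc ρ` (`C²` solutions on the open exterior cone that
  are polynomials in `t` there; in the flat radial case the zero-channel-energy solutions are of
  this form, Kenig–Lawrie–Liu–Schlag §1, Remark 5), the kernel deficit `kernelDeficit`, and the
  two-ended **channel inequality** predicate `ChannelInequality V xc ρ c`.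
* `IsRWSolution M s ℓ r ψ := IsSolution (linePotential M s ℓ r) ψ`; static solutions and their
  first `t`-descendants lie in the kernel (`const_mem_rwKernel`, `mul_mem_rwKernel`), so
  `kernelDeficit ≤` the exterior energy of the data.

Usage: over this vocabulary the uniform photon-sphere channel conjecture of the route reads
`∀ M > 0, ∃ ρ₀ ≥ 0, ∃ c > 0, ∀ r xc, IsTortoiseRadius M r xc → ∀ s ≤ 2, ∀ ℓ ≥ s, ∀ ρ ≥ ρ₀,
ChannelInequality (linePotential M s ℓ r) xc ρ c` (unfold `ChannelInequality`, `kernelDeficit`,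
`rwKernel`, `channelEnergy`, `exteriorEnergy`, `energyDensity` to recover the inlined `let`s), and the
blindness item is about `farChannelEnergy (linePotential M 2 ℓ r) xe ψ atTop/atBot`,
`totalEnergy … ψ 0` and `CauchyDataSupportedOn ψ (Ioo xe xc)`.

Design: derivatives are Mathlib's `deriv` / `iteratedDeriv 2` of the coordinate slices, domains
are the literal sets `{x | ρ + |t| < |x − xc|}`, and energies are lower Lebesgue integrals in `ℝ≥0∞`
(no finiteness built in) — verbatim the objects inlined by the items of route
`PhotonSphereChannels` (Final State Conjecture), which this vocabulary restates.  Deliberately NOT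
here: the even-parity (Zerilli) potential, Kerr, the monotonicity of the exterior energy (energy
flux identity; a theorem for a later file) and any channel-of-energy *theorem* for these
potentials (none is published).

## References

* T. Regge, J. A. Wheeler, Phys. Rev. 108 (1957) 1063–1069 (key `ReggeWheeler1957`; the `s = 2`
  equation, cited here through Chandrasekhar's treatise).
* S. Chandrasekhar, *The Mathematical Theory of Black Holes*, OUP, Ch. 4 §24, eqs. (25)–(28),
  p. 144 (key `Chandrasekhar1998`).
* R. Brito, V. Cardoso, P. Pani, *Superradiance*, 2nd ed., LNP 971 (2020), App. F, eq. (F.1)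
  (key `BritoCardosoPani2020`).
* M. Dafermos, I. Rodnianski, arXiv:0811.0354, §§3–4, App. F.2 (key `DafermosRodnianski2008`).
* C. Kenig, A. Lawrie, B. Liu, W. Schlag, Adv. Math. 285 (2015) 877–936, §1
  (key `KenigEtAl2015`).
* T. Duyckaerts, C. Kenig, F. Merle, Camb. J. Math. 1 (2013) 75–144
  (key `DuyckaertsKenigMerle2013`).
* R. Côte, C. Laurent, Rev. Mat. Iberoam. 40 (2024) 201–250 (key `CoteLaurent2024`).
-/

noncomputable section

open Filter Set MeasureTheory
open scoped ENNReal Topology BigOperators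

namespace Literature.Geometry.Lorentzian

namespace ReggeWheeler

/-! ### The Regge–Wheeler potentials -/

/-- The **spin-`s` Regge–Wheeler potential** of angular number `ℓ` on Schwarzschild of mass `M`,
as a function of the area radius `ρ`:
`V_{s,ℓ}(ρ) = (1 − 2M/ρ)(ℓ(ℓ+1)/ρ² + (1 − s²)·2M/ρ³)` — `s = 0`: scalar waves, `s = 1`: Maxwell,
`s = 2`: odd-parity (axial) metric perturbations (Regge–Wheeler; Chandrasekhar, Ch. 4 §24 (28):
`V⁻ = (Δ/ρ⁵)((μ² + 2)ρ − 6M)`, `μ² + 2 = ℓ(ℓ+1)`).  Unified form: Brito–Cardoso–Pani (F.1),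
`V_{sℓ} = f[ℓ(ℓ+1)/r² + (1 − s²)(f′/f − B′/B)/(2rB)]`, `ℓ ≥ s`, read in vacuum (`f = 1/B = 1 − 2M/r`,
no fluid terms).  (Junk value at `ρ = 0` from `x/0 = 0`.)
[cite: BritoCardosoPani2020, App. F eq. (F.1)] -/
def rwPotential (M : ℝ) (s ℓ : ℕ) (ρ : ℝ) : ℝ :=
  (1 - 2 * M / ρ) * ((ℓ : ℝ) * ((ℓ : ℝ) + 1) / ρ ^ 2 + (1 - (s : ℝ) ^ 2) * (2 * M) / ρ ^ 3)

/-- The potential **on the tortoise line**: `V(x) = V_{s,ℓ}(r(x))`. [folklore] -/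
def linePotential (M : ℝ) (s ℓ : ℕ) (r : ℝ → ℝ) : ℝ → ℝ := fun x ↦ rwPotential M s ℓ (r x)

/-- Unfolding `linePotential`. [folklore] -/
@[simp]
theorem linePotential_apply (M : ℝ) (s ℓ : ℕ) (r : ℝ → ℝ) (x : ℝ) :
    linePotential M s ℓ r x = rwPotential M s ℓ (r x) := rfl

/-- The `s = 2` potential is the Regge–Wheeler potential `(1 − 2M/ρ)(ℓ(ℓ+1)/ρ² − 6M/ρ³)`
`= (Δ/ρ⁵)((μ² + 2)ρ − 6M)`, `Δ = ρ² − 2Mρ`, `μ² + 2 = ℓ(ℓ+1)`. [cite: Chandrasekhar1998, Ch. 4 §24 eq. (28)] -/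
theorem rwPotential_two (M : ℝ) (ℓ : ℕ) (ρ : ℝ) :
    rwPotential M 2 ℓ ρ = (1 - 2 * M / ρ) * ((ℓ : ℝ) * ((ℓ : ℝ) + 1) / ρ ^ 2 - 6 * M / ρ ^ 3) := by
  unfold rwPotential
  ring

/-- The `s = 1` (Maxwell) potential is the pure centrifugal term `(1 − 2M/ρ) ℓ(ℓ+1)/ρ²`.
[cite: BritoCardosoPani2020, App. F eq. (F.1)] -/
theorem rwPotential_one (M : ℝ) (ℓ : ℕ) (ρ : ℝ) :
    rwPotential M 1 ℓ ρ = (1 - 2 * M / ρ) * ((ℓ : ℝ) * ((ℓ : ℝ) + 1) / ρ ^ 2) := by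
  unfold rwPotential
  ring

/-- The `s = 0` (scalar wave) potential is `(1 − 2M/ρ)(ℓ(ℓ+1)/ρ² + 2M/ρ³)` (the Schwarzschild case
of Carter's separated potential `(r − 2M)(ℓ(ℓ+1)/r³ + 2M/r⁴)`, cf. `Kerr.sepPotential_schwarzschild`).
[cite: DafermosRodnianskiShlapentokhrothman2014, §5.2.3] -/
theorem rwPotential_zero (M : ℝ) (ℓ : ℕ) (ρ : ℝ) :
    rwPotential M 0 ℓ ρ = (1 - 2 * M / ρ) * ((ℓ : ℝ) * ((ℓ : ℝ) + 1) / ρ ^ 2 + 2 * M / ρ ^ 3) := by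
  unfold rwPotential
  push_cast
  ring

/-- The potentials vanish at the horizon `ρ = 2M`. [folklore] -/
@[simp]
theorem rwPotential_two_mul (M : ℝ) (s ℓ : ℕ) : rwPotential M s ℓ (2 * M) = 0 := by
  unfold rwPotential
  by_cases hM : M = 0
  · subst hM
    simp
  · have : (1 : ℝ) - 2 * M / (2 * M) = 0 := by
      rw [div_self (by simpa using hM)]
      ring
    rw [this, zero_mul]

/-- **Nonnegativity**: `V_{s,ℓ}(ρ) ≥ 0` for `ℓ ≥ s`, `M ≥ 0` and `ρ ≥ 2M`, `ρ > 0`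
(since `ℓ(ℓ+1)ρ + (1 − s²)2M ≥ 2M(ℓ² + ℓ + 1 − s²) ≥ 0`). [folklore] -/
theorem rwPotential_nonneg {M : ℝ} {s ℓ : ℕ} {ρ : ℝ} (hM : 0 ≤ M) (hsℓ : s ≤ ℓ)
    (h2 : 2 * M ≤ ρ) (hρ : 0 < ρ) : 0 ≤ rwPotential M s ℓ ρ := by
  unfold rwPotential
  have hρ0 : ρ ≠ 0 := hρ.ne'
  have hsl : (s : ℝ) ≤ ℓ := by exact_mod_cast hsℓ
  have hs0 : (0 : ℝ) ≤ s := by exact_mod_cast Nat.zero_le s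
  have hl0 : (0 : ℝ) ≤ ℓ := by exact_mod_cast Nat.zero_le ℓ
  have hfac : 0 ≤ 1 - 2 * M / ρ := by
    rw [_root_.sub_nonneg, div_le_one hρ]
    exact h2
  refine mul_nonneg hfac ?_
  have hA : (s : ℝ) ^ 2 ≤ (ℓ : ℝ) * ((ℓ : ℝ) + 1) := by
    have : (s : ℝ) * s ≤ ℓ * ℓ := mul_le_mul hsl hsl hs0 hl0
    nlinarith
  have hB : (ℓ : ℝ) * ((ℓ : ℝ) + 1) * (2 * M) ≤ (ℓ : ℝ) * ((ℓ : ℝ) + 1) * ρ :=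
    mul_le_mul_of_nonneg_left h2 (by positivity)
  have hnum : 0 ≤ (ℓ : ℝ) * ((ℓ : ℝ) + 1) * ρ + (1 - (s : ℝ) ^ 2) * (2 * M) := by
    have key : (ℓ : ℝ) * ((ℓ : ℝ) + 1) * ρ + (1 - (s : ℝ) ^ 2) * (2 * M) =
        ((ℓ : ℝ) * ((ℓ : ℝ) + 1) * ρ - (ℓ : ℝ) * ((ℓ : ℝ) + 1) * (2 * M)) +
          ((ℓ : ℝ) * ((ℓ : ℝ) + 1) - (s : ℝ) ^ 2) * (2 * M) + 2 * M := by ring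
    rw [key]
    exact add_nonneg (add_nonneg (sub_nonneg.2 hB) (mul_nonneg (sub_nonneg.2 hA) (by linarith)))
      (by linarith)
  rw [div_add_div _ _ (pow_ne_zero 2 hρ0) (pow_ne_zero 3 hρ0)]
  refine div_nonneg ?_ (by positivity)
  have key' : (ℓ : ℝ) * ((ℓ : ℝ) + 1) * ρ ^ 3 + ρ ^ 2 * ((1 - (s : ℝ) ^ 2) * (2 * M)) =
      ρ ^ 2 * ((ℓ : ℝ) * ((ℓ : ℝ) + 1) * ρ + (1 - (s : ℝ) ^ 2) * (2 * M)) := by ring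
  rw [key']
  exact mul_nonneg (by positivity) hnum

/-- Nonnegativity of the potential on the tortoise line along a radius function `r > 2M ≥ 0`,
`ℓ ≥ s`. [folklore] -/
theorem linePotential_nonneg {M : ℝ} {s ℓ : ℕ} {r : ℝ → ℝ} (hM : 0 ≤ M) (hsℓ : s ≤ ℓ)
    (hr : ∀ x, 2 * M < r x) (x : ℝ) : 0 ≤ linePotential M s ℓ r x :=
  rwPotential_nonneg hM hsℓ (hr x).le (by linarith [hr x])

/-- The potential on the tortoise line is continuous along a continuous radius function
`r ≠ 0`. [folklore] -/
theorem continuous_linePotential {M : ℝ} (s ℓ : ℕ) {r : ℝ → ℝ} (hc : Continuous r)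
    (hr0 : ∀ x, r x ≠ 0) : Continuous (linePotential M s ℓ r) := by
  unfold linePotential rwPotential
  refine (continuous_const.sub (continuous_const.div hc hr0)).mul
    ((continuous_const.div (hc.pow 2) fun x ↦ pow_ne_zero _ (hr0 x)).add
      (continuous_const.div (hc.pow 3) fun x ↦ pow_ne_zero _ (hr0 x)))

/-- **The photon sphere maximises the centrifugal barrier**: `(1 − 2M/ρ)/ρ² ≤ 1/(27M²)` for
`ρ > 0`, `M > 0` (as `ρ³ − 27M²ρ + 54M³ = (ρ − 3M)²(ρ + 6M) ≥ 0`), with equality at `ρ = 3M`.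
In particular the `s = 1` potential peaks exactly at `r = 3M` for every `ℓ`. [folklore] -/
theorem centrifugal_le {M ρ : ℝ} (hM : 0 < M) (hρ : 0 < ρ) :
    (1 - 2 * M / ρ) / ρ ^ 2 ≤ 1 / (27 * M ^ 2) := by
  rw [div_le_div_iff₀ (by positivity) (by positivity)]
  have h1 : (1 - 2 * M / ρ) * (27 * M ^ 2) = 27 * M ^ 2 * (ρ - 2 * M) / ρ := by
    field_simp
  rw [h1, div_le_iff₀ hρ]
  nlinarith [sq_nonneg (ρ - 3 * M), mul_nonneg (sq_nonneg (ρ - 3 * M)) (by linarith : 0 ≤ ρ + 6 * M)]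

/-- Equality case of `centrifugal_le`: at the photon sphere `(1 − 2M/3M)/(3M)² = 1/(27M²)`.
[folklore] -/
theorem centrifugal_photonSphere {M : ℝ} (hM : M ≠ 0) :
    (1 - 2 * M / (3 * M)) / (3 * M) ^ 2 = 1 / (27 * M ^ 2) := by
  field_simp
  ring

/-! ### Waves with a potential on the line: solutions, energies, channels -/

variable (V : ℝ → ℝ)

/-- The **energy density** `e[φ](t,x) = φ_t² + φ_x² + V(x) φ²` of `φ_tt − φ_xx + Vφ = 0`.
[cite: KenigEtAl2015, §1] -/
def energyDensity (φ : ℝ → ℝ → ℝ) (t x : ℝ) : ℝ :=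
  deriv (fun τ ↦ φ τ x) t ^ 2 + deriv (φ t) x ^ 2 + V x * φ t x ^ 2

/-- The energy density is nonnegative wherever `V ≥ 0`. [folklore] -/
theorem energyDensity_nonneg {V : ℝ → ℝ} (φ : ℝ → ℝ → ℝ) (t : ℝ) {x : ℝ} (hV : 0 ≤ V x) :
    0 ≤ energyDensity V φ t x := by
  unfold energyDensity
  positivity

/-- `φ` **solves** `φ_tt − φ_xx + V φ = 0` **at** the point `z = (t, x)` (second derivatives as
`iteratedDeriv 2` of the coordinate slices). [folklore] -/
def IsSolutionAt (φ : ℝ → ℝ → ℝ) (z : ℝ × ℝ) : Prop :=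
  iteratedDeriv 2 (fun τ ↦ φ τ z.2) z.1 - iteratedDeriv 2 (φ z.1) z.2 + V z.2 * φ z.1 z.2 = 0

/-- Classical (`C²`) solution **on a set** `Ω ⊆ ℝ_t × ℝ_x`. [folklore] -/
def IsSolutionOn (φ : ℝ → ℝ → ℝ) (Ω : Set (ℝ × ℝ)) : Prop :=
  ContDiffOn ℝ 2 (Function.uncurry φ) Ω ∧ ∀ z ∈ Ω, IsSolutionAt V φ z

/-- **Global classical solution**: `φ ∈ C²(ℝ²)` and `φ_tt − φ_xx + Vφ = 0` everywhere. [folklore] -/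
def IsSolution (φ : ℝ → ℝ → ℝ) : Prop :=
  ContDiff ℝ 2 (Function.uncurry φ) ∧ ∀ z, IsSolutionAt V φ z

variable {V} in
/-- A global solution is a solution on every set. [folklore] -/
theorem IsSolution.isSolutionOn {φ : ℝ → ℝ → ℝ} (h : IsSolution V φ) (Ω : Set (ℝ × ℝ)) :
    IsSolutionOn V φ Ω :=
  ⟨h.1.contDiffOn, fun z _ ↦ h.2 z⟩

/-- The open **exterior cone** `{(t, x) | ρ + |t| < |x − xc|}` outside the ball of radius `ρ`
centred at `xc`, two-ended in time. [cite: KenigEtAl2015, §1] -/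
def exteriorCone (xc ρ : ℝ) : Set (ℝ × ℝ) := {z | ρ + |z.1| < |z.2 - xc|}

/-- Membership in the exterior cone. [folklore] -/
@[simp]
theorem mem_exteriorCone {xc ρ : ℝ} {z : ℝ × ℝ} :
    z ∈ exteriorCone xc ρ ↔ ρ + |z.1| < |z.2 - xc| := Iff.rfl

/-- The exterior cone is open. [folklore] -/
theorem isOpen_exteriorCone (xc ρ : ℝ) : IsOpen (exteriorCone xc ρ) :=
  isOpen_lt (by fun_prop) (by fun_prop)

/-- The **exterior energy** at time `t` outside the cone of aperture `ρ` about `xc`: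
`E_ext(t) = ∫_{ρ + |t| < |x − xc|} e[φ](t, x) dx ∈ [0, ∞]`. [cite: KenigEtAl2015, §1] -/
def exteriorEnergy (xc ρ : ℝ) (φ : ℝ → ℝ → ℝ) (t : ℝ) : ℝ≥0∞ :=
  ∫⁻ x in {x : ℝ | ρ + |t| < |x - xc|}, ENNReal.ofReal (energyDensity V φ t x)

/-- The **channel energy** of `φ` through the exterior channel `{ρ + |t| < |x − xc|}` along the
time filter `l`: `liminf_l E_ext(t)`; `l = atTop` is the energy escaping forward in time (to `𝓘⁺`
on the far side, into `𝓗⁺` on the near side), `l = atBot` the energy entering from the past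
channel ends.  (For `V ≥ 0` the exterior energy is non-increasing on `t ≥ 0` and non-decreasing
on `t ≤ 0` by the energy-flux identity, so along `atTop`/`atBot` the `liminf` is a limit and an
infimum; that identity is not proved in this file.) [cite: KenigEtAl2015, §1] -/
def channelEnergy (xc ρ : ℝ) (φ : ℝ → ℝ → ℝ) (l : Filter ℝ) : ℝ≥0∞ :=
  liminf (exteriorEnergy V xc ρ φ) l

/-- The **one-ended far energy** at time `t` beyond the edge `xe`: `∫_{x > xe + |t|} e[φ](t,x) dx`.
[cite: DuyckaertsKenigMerle2013, §1] -/
def farEnergy (xe : ℝ) (φ : ℝ → ℝ → ℝ) (t : ℝ) : ℝ≥0∞ :=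
  ∫⁻ x in {x : ℝ | xe + |t| < x}, ENNReal.ofReal (energyDensity V φ t x)

/-- The **far channel energy** `liminf_l ∫_{x > xe + |t|} e[φ](t,x) dx` through the one-ended
channel `{x > xe + |t|}` (radiation to `𝓘⁺`/from `𝓘⁻` only). [cite: DuyckaertsKenigMerle2013, §1] -/
def farChannelEnergy (xe : ℝ) (φ : ℝ → ℝ → ℝ) (l : Filter ℝ) : ℝ≥0∞ :=
  liminf (farEnergy V xe φ) l

/-- The **total energy** `∫_ℝ e[φ](t, x) dx ∈ [0, ∞]` at time `t`. [folklore] -/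
def totalEnergy (φ : ℝ → ℝ → ℝ) (t : ℝ) : ℝ≥0∞ :=
  ∫⁻ x, ENNReal.ofReal (energyDensity V φ t x)

/-- The far energy is at most the total energy. [folklore] -/
theorem farEnergy_le_totalEnergy (xe : ℝ) (φ : ℝ → ℝ → ℝ) (t : ℝ) :
    farEnergy V xe φ t ≤ totalEnergy V φ t :=
  setLIntegral_le_lintegral _ _

/-- The exterior energy is at most the total energy. [folklore] -/
theorem exteriorEnergy_le_totalEnergy (xc ρ : ℝ) (φ : ℝ → ℝ → ℝ) (t : ℝ) :
    exteriorEnergy V xc ρ φ t ≤ totalEnergy V φ t :=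
  setLIntegral_le_lintegral _ _

/-- The **Cauchy data** `(φ, φ_t)|_{t=0}` of `φ` **vanish off** the set `S`. [folklore] -/
def CauchyDataSupportedOn (φ : ℝ → ℝ → ℝ) (S : Set ℝ) : Prop :=
  ∀ x ∉ S, φ 0 x = 0 ∧ deriv (fun τ ↦ φ τ x) 0 = 0

/-- For an interval `(xe, xc)` this is the support clause of the blindness item:
`x ≤ xe ∨ xc ≤ x → φ(0,x) = 0 ∧ φ_t(0,x) = 0`. [folklore] -/
theorem cauchyDataSupportedOn_Ioo {φ : ℝ → ℝ → ℝ} {xe xc : ℝ} :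
    CauchyDataSupportedOn φ (Ioo xe xc) ↔
      ∀ x, x ≤ xe ∨ xc ≤ x → φ 0 x = 0 ∧ deriv (fun τ ↦ φ τ x) 0 = 0 := by
  refine forall_congr' fun x ↦ ?_
  rw [mem_Ioo, not_and_or, not_lt, not_lt]

/-- `φ` is a **polynomial in `t` on `Ω`**: `φ(t, x) = Σ_{i<N} aᵢ(x) tⁱ` there. [folklore] -/
def IsPolynomialInTimeOn (φ : ℝ → ℝ → ℝ) (Ω : Set (ℝ × ℝ)) : Prop :=
  ∃ (N : ℕ) (a : ℕ → ℝ → ℝ), ∀ z ∈ Ω, φ z.1 z.2 = ∑ i ∈ Finset.range N, a i z.2 * z.1 ^ i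

/-- The candidate **non-radiative kernel** `P(ρ)` of the exterior channel about `xc`: `C²`
solutions on the open exterior cone `{ρ + |t| < |x − xc|}` which are polynomials in `t` there
(static multipoles, linearised charges and their `t`-descendants).  In the flat radial case the
solutions with vanishing channel energy are exactly of this form (Kenig–Lawrie–Liu–Schlag,
Remark 5). [cite: KenigEtAl2015, §1 Remark 5] -/
def rwKernel (xc ρ : ℝ) : Set (ℝ → ℝ → ℝ) :=
  {p | ContDiffOn ℝ 2 (Function.uncurry p) (exteriorCone xc ρ) ∧
    (∀ z ∈ exteriorCone xc ρ, IsSolutionAt V p z) ∧ IsPolynomialInTimeOn p (exteriorCone xc ρ)}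

variable {V} in
/-- The kernel consists of the solutions on the exterior cone that are polynomial in `t` there.
[folklore] -/
theorem mem_rwKernel_iff {xc ρ : ℝ} {p : ℝ → ℝ → ℝ} :
    p ∈ rwKernel V xc ρ ↔
      IsSolutionOn V p (exteriorCone xc ρ) ∧ IsPolynomialInTimeOn p (exteriorCone xc ρ) := by
  simp only [rwKernel, IsSolutionOn, mem_setOf_eq, and_assoc]

/-- The **kernel deficit** of `φ` at `t = 0`: the exterior-energy distance (squared) from `φ` to
the kernel, `inf_{p ∈ P(ρ)} ∫_{ρ < |x − xc|} e[φ − p](0, x) dx`. [cite: KenigEtAl2015, §1] -/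
def kernelDeficit (xc ρ : ℝ) (φ : ℝ → ℝ → ℝ) : ℝ≥0∞ :=
  ⨅ p ∈ rwKernel V xc ρ,
    ∫⁻ x in {x : ℝ | ρ < |x - xc|}, ENNReal.ofReal (energyDensity V (fun t y ↦ φ t y - p t y) 0 x)

/-- The two-ended **exterior channel-of-energy inequality** with constant `c` for the channel of
aperture `ρ` about `xc`: for every global `C²` solution,
`c · inf_{p ∈ P(ρ)} E_ext[φ − p](0) ≤ liminf_{t → +∞} E_ext[φ](t) + liminf_{t → −∞} E_ext[φ](t)`.
(The flat radial model: Duyckaerts–Kenig–Merle; Kenig–Lawrie–Liu–Schlag, main theorem, with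
`max` in place of the sum.)  A predicate — no claim is made here. [cite: KenigEtAl2015, §1] -/
def ChannelInequality (xc ρ c : ℝ) : Prop :=
  ∀ φ : ℝ → ℝ → ℝ, IsSolution V φ →
    ENNReal.ofReal c * kernelDeficit V xc ρ φ ≤
      channelEnergy V xc ρ φ atTop + channelEnergy V xc ρ φ atBot

/-! ### The Regge–Wheeler specialisation and the static part of the kernel -/

/-- `ψ` is a global `C²` solution of the **Regge–Wheeler equation**
`ψ_tt − ψ_xx + V_{s,ℓ}(r(x)) ψ = 0` on the tortoise line. [cite: Chandrasekhar1998, Ch. 4 §24 eq. (27)] -/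
abbrev IsRWSolution (M : ℝ) (s ℓ : ℕ) (r : ℝ → ℝ) (ψ : ℝ → ℝ → ℝ) : Prop :=
  IsSolution (linePotential M s ℓ r) ψ

variable {V}

/-- `iteratedDeriv 2` of an affine function of `t` vanishes. [folklore] -/
theorem iteratedDeriv_two_mul_const (c t : ℝ) : iteratedDeriv 2 (fun τ : ℝ ↦ τ * c) t = 0 := by
  have hd : ∀ τ : ℝ, HasDerivAt (fun y : ℝ ↦ y * c) (1 * c) τ := fun τ ↦
    (hasDerivAt_id' τ).mul_const c
  have h1 : deriv (fun y : ℝ ↦ y * c) = fun _ ↦ 1 * c := funext fun τ ↦ (hd τ).deriv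
  rw [iteratedDeriv_succ, iteratedDeriv_one, h1]
  simp

/-- **Static solutions lie in the kernel**: if `S ∈ C²(ℝ)` solves `−S'' + V S = 0`, then
`(t, x) ↦ S(x)` belongs to `rwKernel V xc ρ` for every channel. [folklore] -/
theorem const_mem_rwKernel {S : ℝ → ℝ} (hS : ContDiff ℝ 2 S)
    (hstat : ∀ x, iteratedDeriv 2 S x = V x * S x) (xc ρ : ℝ) :
    (fun (_ : ℝ) (x : ℝ) ↦ S x) ∈ rwKernel V xc ρ := by
  refine ⟨?_, fun z _ ↦ ?_, ⟨1, fun _ ↦ S, fun z _ ↦ by simp⟩⟩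
  · exact (hS.comp contDiff_snd).contDiffOn
  · show iteratedDeriv 2 (fun _ : ℝ ↦ S z.2) z.1 - iteratedDeriv 2 (fun x ↦ S x) z.2
        + V z.2 * S z.2 = 0
    rw [iteratedDeriv_const]
    have : (fun x ↦ S x) = S := rfl
    rw [this, hstat]
    simp

/-- **First `t`-descendants of static solutions lie in the kernel**: with `S` as above,
`(t, x) ↦ t · S(x)` belongs to `rwKernel V xc ρ`. [folklore] -/
theorem mul_mem_rwKernel {S : ℝ → ℝ} (hS : ContDiff ℝ 2 S)
    (hstat : ∀ x, iteratedDeriv 2 S x = V x * S x) (xc ρ : ℝ) :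
    (fun (t : ℝ) (x : ℝ) ↦ t * S x) ∈ rwKernel V xc ρ := by
  refine ⟨?_, fun z _ ↦ ?_, ⟨2, fun i ↦ if i = 1 then S else 0, fun z _ ↦ ?_⟩⟩
  · exact (contDiff_fst.mul (hS.comp contDiff_snd)).contDiffOn
  · show iteratedDeriv 2 (fun τ : ℝ ↦ τ * S z.2) z.1 - iteratedDeriv 2 (fun x ↦ z.1 * S x) z.2
        + V z.2 * (z.1 * S z.2) = 0
    rw [iteratedDeriv_two_mul_const, iteratedDeriv_const_mul_field, hstat]
    ring
  · simp [Finset.sum_range_succ, mul_comm]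

/-- The zero function lies in the kernel. [folklore] -/
theorem zero_mem_rwKernel (xc ρ : ℝ) : (fun (_ : ℝ) (_ : ℝ) ↦ (0 : ℝ)) ∈ rwKernel V xc ρ := by
  simpa using const_mem_rwKernel (V := V) (S := fun _ ↦ 0) contDiff_const (fun x ↦ by simp) xc ρ

/-- Hence the kernel deficit never exceeds the exterior energy of the data themselves. [folklore] -/
theorem kernelDeficit_le (xc ρ : ℝ) (φ : ℝ → ℝ → ℝ) :
    kernelDeficit V xc ρ φ ≤
      ∫⁻ x in {x : ℝ | ρ < |x - xc|}, ENNReal.ofReal (energyDensity V φ 0 x) := by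
  refine (iInf₂_le _ (zero_mem_rwKernel (V := V) xc ρ)).trans (le_of_eq ?_)
  simp

end ReggeWheeler

end Literature.Geometry.Lorentzian
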